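import Mathlib

/-!
# NE7K1LinWalkProfile — row NE7 (node U5), candidate route HOM, path H1L, cell K1-lin(s): A C^{1,1} PIECEWISE-QUADRATIC PARTITION OF
# UNITY ON ℝ — the one-dimensional profile of the random-walk cut-offs (B4 §2's `h_j`, here WITHOUT square roots and WITHOUT calculus)

Lineage `b2b-balaban-t4-ne7-p2` (CRUX PROVER NE7 #2), generation 68; series (RW) file 5 (independent; `import Mathlib` only).  B4
([Balaban1983RegularityDecay], Commun. Math. Phys. 89 (1983) p. 575) takes smooth cut-offs `h_j` with `Σ_j h_j² = 1`, `|∂h_j| = O(M^{−1})`,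
`|Δh_j| = O(M^{−2})`.  The random-walk smallness needs exactly: bounded, Lipschitz on scale `M`, second differences `O(M^{−2})`, a
partition of unity by translates, and (for Neumann regions) PLATEAUS where region faces sit.  All five are delivered by ONE explicit
piecewise-quadratic profile, every fact proved by finite case analysis on `max`:

* `q t = max t 0 ²` (the C^{1,1} primitive): `0 ≤ q(t+h) + q(t−h) − 2q(t) ≤ 2h²` (`q_secondDiff_nonneg ∕ _le`).
* `S = 2q − 4q(·−½) + 2q(·−1)` (smooth step): `S = 0` on `(−∞,0]`, `S = 1` on `[1,∞)`, `S = 2t²` on `[0,½]`, `S = 1 − 2(1−t)²` on `[½,1]`,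
  `0 ≤ S ≤ 1`, `|S b − S a| ≤ 2|b − a|` (monotone pieces + clamping), `|S(t+h) + S(t−h) − 2S(t)| ≤ 16h²`.
* `Φ = S − S(·−2)` (bump: rises on `[0,1]`, plateau `1` on `[1,2]`, falls on `[2,3]`): `0 ≤ Φ ≤ 1`, `Φ = 0` off `(0,3)`, `Φ = 1` on `[1,2]`,
  `|Φ b − Φ a| ≤ 4|b − a|`, `|Φ(t+h) + Φ(t−h) − 2Φ(t)| ≤ 32h²`; **`sum_Phi_range`**: `Σ_{J<K+1} Φ(t − 2J) = S(t) − S(t − 2(K+1))`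
  (telescoping) — hence `= 1` for `1 ≤ t ≤ 2K+2` (`sum_Phi_eq_one`): the PARTITION OF UNITY by even translates; **`Phi_flat_int`**: for
  every INTEGER `J`, `θ ↦ Φ(1 − 2J + θ)` is constant on `[0,1]` (the plateaus and zero-sets tile the odd unit intervals) — the Neumann
  compatibility used at the faces of an aligned box (file 6).

HONEST FRAMING: [folklore] elementary real inequalities; no lattice, no operator; nothing of Bałaban's asserted; no `sorry`.  Census only;
NO letter ∕ tag ∕ size of NE7 moves; NE7 NOT PRINTED ∕ NOT PROVED; spine 0∕9; FIXED FINITE T⁴, rung (B)+1; NOT infinite volume, NOT mass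
gap, NOT Clay.  HONEST DEPENDENCY: continuum YM on T⁴ ⇐ BetaPertH ∧ nine spine estimates (0/9 proved); BetaPertH ⇐ (D1) ∧ (D4) ∧
CAP+tail; G-an2-4 gates asym, D1 and NE2/3/4.
-/

noncomputable section

namespace Summit.QuantumFields.BalabanUV.T4Continuum.NE7K1LinWalkProfile

/-! ### §1 The C^{1,1} primitive `q(t) = max(t,0)²` -/

/-- `q(t) = max(t,0)²`, the once-integrated ramp. [folklore] -/
def q (t : ℝ) : ℝ := max t 0 ^ 2

/-- `q = 0` on `(−∞, 0]`. [folklore] -/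
theorem q_of_nonpos {t : ℝ} (ht : t ≤ 0) : q t = 0 := by simp [q, max_eq_right ht]

/-- `q(t) = t²` on `[0, ∞)`. [folklore] -/
theorem q_of_nonneg {t : ℝ} (ht : 0 ≤ t) : q t = t ^ 2 := by simp [q, max_eq_left ht]

/-- **THE SECOND DIFFERENCE OF `q` IS BETWEEN `0` AND `2h²`** (`h ≥ 0`): the discrete form of `0 ≤ q″ ≤ 2`. [folklore] -/
theorem q_secondDiff {t h : ℝ} (hh : 0 ≤ h) : 0 ≤ q (t + h) + q (t - h) - 2 * q t ∧ q (t + h) + q (t - h) - 2 * q t ≤ 2 * h ^ 2 := by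
  by_cases h1 : t + h ≤ 0
  · rw [q_of_nonpos h1, q_of_nonpos (by linarith), q_of_nonpos (by linarith)]
    constructor <;> nlinarith
  · push Not at h1
    rw [q_of_nonneg h1.le]
    by_cases h2 : 0 ≤ t - h
    · rw [q_of_nonneg h2, q_of_nonneg (by linarith)]
      constructor <;> nlinarith
    · push Not at h2
      rw [q_of_nonpos h2.le]
      by_cases h3 : 0 ≤ t
      · rw [q_of_nonneg h3]; constructor <;> nlinarith
      · push Not at h3
        rw [q_of_nonpos h3.le]; constructor <;> nlinarith

/-! ### §2 The smooth step `S` -/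

/-- `S = 2q − 4q(·−½) + 2q(·−1)`: `0` left of `0`, `2t²` on `[0,½]`, `1 − 2(1−t)²` on `[½,1]`, `1` right of `1`. [folklore] -/
def S (t : ℝ) : ℝ := 2 * q t - 4 * q (t - 1 / 2) + 2 * q (t - 1)

/-- `S = 0` on `(−∞,0]`. [folklore] -/
theorem S_of_nonpos {t : ℝ} (ht : t ≤ 0) : S t = 0 := by
  rw [S, q_of_nonpos ht, q_of_nonpos (by linarith), q_of_nonpos (by linarith)]; ring

/-- `S = 1` on `[1,∞)`. [folklore] -/
theorem S_of_one_le {t : ℝ} (ht : 1 ≤ t) : S t = 1 := by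
  rw [S, q_of_nonneg (by linarith), q_of_nonneg (by linarith), q_of_nonneg (by linarith)]; ring

/-- `S(t) = 2t²` on `[0,½]`. [folklore] -/
theorem S_of_le_half {t : ℝ} (h0 : 0 ≤ t) (h1 : t ≤ 1 / 2) : S t = 2 * t ^ 2 := by
  rw [S, q_of_nonneg h0, q_of_nonpos (by linarith), q_of_nonpos (by linarith)]; ring

/-- `S(t) = 1 − 2(1−t)²` on `[½,1]`. [folklore] -/
theorem S_of_half_le {t : ℝ} (h0 : 1 / 2 ≤ t) (h1 : t ≤ 1) : S t = 1 - 2 * (1 - t) ^ 2 := by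
  rw [S, q_of_nonneg (by linarith), q_of_nonneg (by linarith), q_of_nonpos (by linarith)]; ring

/-- on `[0,1]`, `S` is monotone with slope at most `2`: `0 ≤ S v − S u ≤ 2(v − u)` for `0 ≤ u ≤ v ≤ 1`. [folklore] -/
theorem S_sub_S_of_le {u v : ℝ} (hu : 0 ≤ u) (huv : u ≤ v) (hv : v ≤ 1) : 0 ≤ S v - S u ∧ S v - S u ≤ 2 * (v - u) := by
  by_cases h1 : v ≤ 1 / 2
  · rw [S_of_le_half hu (huv.trans h1), S_of_le_half (hu.trans huv) h1]
    constructor <;> nlinarith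
  · push Not at h1
    rw [S_of_half_le h1.le hv]
    by_cases h2 : u ≤ 1 / 2
    · rw [S_of_le_half hu h2]
      constructor <;> nlinarith [sq_nonneg (v - 1 / 2), sq_nonneg (u - 1 / 2)]
    · push Not at h2
      rw [S_of_half_le h2.le (huv.trans hv)]
      constructor <;> nlinarith

/-- `S` is unchanged by clamping to `[0,1]`. [folklore] -/
theorem S_clamp (t : ℝ) : S (max 0 (min t 1)) = S t := by
  by_cases h0 : t ≤ 0
  · rw [min_eq_left (by linarith : t ≤ 1), max_eq_left h0, S_of_nonpos le_rfl, S_of_nonpos h0]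
  · push Not at h0
    by_cases h1 : 1 ≤ t
    · rw [min_eq_right h1, max_eq_right zero_le_one, S_of_one_le le_rfl, S_of_one_le h1]
    · push Not at h1
      rw [min_eq_left h1.le, max_eq_right h0.le]

/-- clamping is `1`-Lipschitz. [folklore] -/
theorem abs_clamp_sub_clamp_le (a b : ℝ) : |max 0 (min b 1) - max 0 (min a 1)| ≤ |b - a| := by
  refine (abs_max_sub_max_le_max 0 (min b 1) 0 (min a 1)).trans ?_
  rw [sub_self, abs_zero, max_eq_right (abs_nonneg _)]
  refine (abs_min_sub_min_le_max b 1 a 1).trans ?_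
  rw [sub_self, abs_zero, max_eq_left (abs_nonneg _)]

/-- **`S` IS `2`-LIPSCHITZ ON ℝ**. [folklore] -/
theorem abs_S_sub_S_le (a b : ℝ) : |S b - S a| ≤ 2 * |b - a| := by
  -- reduce to the clamped arguments in `[0,1]`
  rw [← S_clamp a, ← S_clamp b]
  set u := max 0 (min a 1) with hu
  set v := max 0 (min b 1) with hv
  have hu0 : 0 ≤ u := le_max_left _ _
  have hv0 : 0 ≤ v := le_max_left _ _
  have hu1 : u ≤ 1 := max_le zero_le_one (min_le_right _ _)
  have hv1 : v ≤ 1 := max_le zero_le_one (min_le_right _ _)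
  have hcl : |v - u| ≤ |b - a| := abs_clamp_sub_clamp_le a b
  rcases le_total u v with huv | hvu
  · have h := S_sub_S_of_le hu0 huv hv1
    rw [abs_of_nonneg h.1]
    rw [abs_of_nonneg (by linarith : 0 ≤ v - u)] at hcl
    linarith
  · have h := S_sub_S_of_le hv0 hvu hu1
    rw [abs_sub_comm, abs_of_nonneg h.1]
    rw [abs_sub_comm, abs_of_nonneg (by linarith : 0 ≤ u - v)] at hcl
    linarith

/-- `0 ≤ S ≤ 1`. [folklore] -/
theorem S_mem_Icc (t : ℝ) : 0 ≤ S t ∧ S t ≤ 1 := by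
  rw [← S_clamp t]
  set u := max 0 (min t 1)
  have hu0 : 0 ≤ u := le_max_left _ _
  have hu1 : u ≤ 1 := max_le zero_le_one (min_le_right _ _)
  have h1 := S_sub_S_of_le le_rfl hu0 hu1
  have h2 := S_sub_S_of_le hu0 hu1 le_rfl
  rw [S_of_nonpos le_rfl] at h1
  rw [S_of_one_le le_rfl] at h2
  constructor <;> linarith [h1.1, h2.1]

/-- **SECOND DIFFERENCES OF `S` ARE `O(h²)`**: `|S(t+h) + S(t−h) − 2S(t)| ≤ 16h²` (`h ≥ 0`). [folklore] -/
theorem abs_S_secondDiff_le {t h : ℝ} (hh : 0 ≤ h) : |S (t + h) + S (t - h) - 2 * S t| ≤ 16 * h ^ 2 := by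
  have e : S (t + h) + S (t - h) - 2 * S t =
      2 * (q (t + h) + q (t - h) - 2 * q t) - 4 * (q (t - 1 / 2 + h) + q (t - 1 / 2 - h) - 2 * q (t - 1 / 2))
        + 2 * (q (t - 1 + h) + q (t - 1 - h) - 2 * q (t - 1)) := by
    simp only [S]; ring_nf
  have h1 := q_secondDiff (t := t) hh
  have h2 := q_secondDiff (t := t - 1 / 2) hh
  have h3 := q_secondDiff (t := t - 1) hh
  rw [e, abs_le]
  constructor <;> nlinarith [h1.1, h1.2, h2.1, h2.2, h3.1, h3.2]

/-! ### §3 The bump `Φ = S − S(·−2)` and the partition of unity by even translates -/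

/-- `Φ = S − S(·−2)`: rises on `[0,1]`, equals `1` on `[1,2]`, falls on `[2,3]`, vanishes off `(0,3)`. [folklore] -/
def Phi (t : ℝ) : ℝ := S t - S (t - 2)

/-- `Φ = 0` on `(−∞, 0]`. [folklore] -/
theorem Phi_of_nonpos {t : ℝ} (ht : t ≤ 0) : Phi t = 0 := by
  rw [Phi, S_of_nonpos ht, S_of_nonpos (by linarith)]; ring

/-- `Φ = 0` on `[3, ∞)`. [folklore] -/
theorem Phi_of_three_le {t : ℝ} (ht : 3 ≤ t) : Phi t = 0 := by
  rw [Phi, S_of_one_le (by linarith), S_of_one_le (by linarith)]; ring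

/-- `Φ = 1` on the plateau `[1, 2]`. [folklore] -/
theorem Phi_of_mem_plateau {t : ℝ} (h1 : 1 ≤ t) (h2 : t ≤ 2) : Phi t = 1 := by
  rw [Phi, S_of_one_le h1, S_of_nonpos (by linarith)]; ring

/-- `0 ≤ Φ ≤ 1`. [folklore] -/
theorem Phi_mem_Icc (t : ℝ) : 0 ≤ Phi t ∧ Phi t ≤ 1 := by
  rw [Phi]
  by_cases h : t ≤ 2
  · rw [S_of_nonpos (by linarith : t - 2 ≤ 0), sub_zero]; exact S_mem_Icc t
  · push Not at h
    rw [S_of_one_le (by linarith : 1 ≤ t)]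
    have := S_mem_Icc (t - 2)
    constructor <;> linarith [this.1, this.2]

/-- `|Φ| ≤ 1`. [folklore] -/
theorem abs_Phi_le_one (t : ℝ) : |Phi t| ≤ 1 := by
  have := Phi_mem_Icc t
  rw [abs_le]; constructor <;> linarith [this.1]

/-- **`Φ` IS `4`-LIPSCHITZ**. [folklore] -/
theorem abs_Phi_sub_Phi_le (a b : ℝ) : |Phi b - Phi a| ≤ 4 * |b - a| := by
  have e : Phi b - Phi a = (S b - S a) - (S (b - 2) - S (a - 2)) := by simp only [Phi]; ring
  rw [e]
  refine (abs_sub _ _).trans ?_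
  have h1 := abs_S_sub_S_le a b
  have h2 := abs_S_sub_S_le (a - 2) (b - 2)
  rw [show b - 2 - (a - 2) = b - a by ring] at h2
  linarith

/-- **SECOND DIFFERENCES OF `Φ` ARE `O(h²)`**: `|Φ(t+h) + Φ(t−h) − 2Φ(t)| ≤ 32h²` (`h ≥ 0`). [folklore] -/
theorem abs_Phi_secondDiff_le {t h : ℝ} (hh : 0 ≤ h) : |Phi (t + h) + Phi (t - h) - 2 * Phi t| ≤ 32 * h ^ 2 := by
  have e : Phi (t + h) + Phi (t - h) - 2 * Phi t =
      (S (t + h) + S (t - h) - 2 * S t) - (S (t - 2 + h) + S (t - 2 - h) - 2 * S (t - 2)) := by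
    simp only [Phi]; ring_nf
  rw [e]
  refine (abs_sub _ _).trans ?_
  have h1 := abs_S_secondDiff_le (t := t) hh
  have h2 := abs_S_secondDiff_le (t := t - 2) hh
  linarith

/-- **NEUMANN COMPATIBILITY**: for every INTEGER `J`, `Φ(1 − 2J + θ)` does not depend on `θ ∈ [0,1]` (for `J = 0` the interval
`[1,2]` is the plateau, for `J ≥ 1` it lies left of `0`, for `J ≤ −1` right of `3`). [folklore] -/
theorem Phi_flat_int (J : ℤ) {θ θ' : ℝ} (h0 : 0 ≤ θ) (h1 : θ ≤ 1) (h0' : 0 ≤ θ') (h1' : θ' ≤ 1) :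
    Phi (1 - 2 * (J : ℝ) + θ) = Phi (1 - 2 * (J : ℝ) + θ') := by
  rcases lt_trichotomy J 0 with hJ | rfl | hJ
  · have hJ' : (J : ℝ) ≤ -1 := by exact_mod_cast (Int.le_sub_one_iff.mpr hJ : J ≤ 0 - 1)
    rw [Phi_of_three_le (by linarith), Phi_of_three_le (by linarith)]
  · simp only [Int.cast_zero, mul_zero, sub_zero]
    rw [Phi_of_mem_plateau (by linarith) (by linarith), Phi_of_mem_plateau (by linarith) (by linarith)]
  · have hJ' : (1 : ℝ) ≤ J := by exact_mod_cast (hJ : (1 : ℤ) ≤ J)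
    rw [Phi_of_nonpos (by linarith), Phi_of_nonpos (by linarith)]

/-- **TELESCOPING**: `Σ_{J<K+1} Φ(t − 2J) = S(t) − S(t − 2(K+1))`. [folklore] -/
theorem sum_Phi_range (t : ℝ) (K : ℕ) :
    ∑ J ∈ Finset.range (K + 1), Phi (t - 2 * (J : ℝ)) = S t - S (t - 2 * ((K : ℝ) + 1)) := by
  induction K with
  | zero => simp [Phi]
  | succ K ih =>
    rw [Finset.sum_range_succ, ih, Phi]
    push_cast
    ring_nf

/-- **PARTITION OF UNITY BY EVEN TRANSLATES**: for `1 ≤ t ≤ 2K + 2`, `Σ_{J<K+1} Φ(t − 2J) = 1`. [folklore] -/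
theorem sum_Phi_eq_one {t : ℝ} {K : ℕ} (h1 : 1 ≤ t) (h2 : t ≤ 2 * ((K : ℝ) + 1)) :
    ∑ J ∈ Finset.range (K + 1), Phi (t - 2 * (J : ℝ)) = 1 := by
  rw [sum_Phi_range, S_of_one_le h1, S_of_nonpos (by linarith)]; ring

end Summit.QuantumFields.BalabanUV.T4Continuum.NE7K1LinWalkProfile

end
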